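import Literature.NumberTheory.EllipticCurves.SupersingularDensitySerreTraceProofs
import Literature.NumberTheory.EllipticCurves.ModularityVersionApProofs
import HarnessLib

/-!
# A Galois-equivariant isomorphism of `ℓ`-torsion is a congruence of traces of Frobenius

Helper (`--supports`) for the crux `Summit.ABC.ABC.Theses.IsogenyGlueCongruence.PolyFreyMazurPairs`
(stmt-ABC-2047), line `sturm-window-effective-smo`, stub `stub_traceCongruenceMinimal` (the lead's).

**Statement (`stub_traceCongruenceMinimal`).** Let `W, W'` be elliptic curves over `ℚ` given by globally
minimal Weierstrass equations, `ℓ` a prime, `e : W[ℓ] ≃+ W'[ℓ]` a `Gal(ℚ̄/ℚ)`-equivariant isomorphism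
of the geometric `ℓ`-torsion groups, and `p ≠ ℓ` a prime not dividing `N_W N_{W'}`. Then
`a_p(W) ≡ a_p(W') (mod ℓ)`, the `a_p` being the `p`-th coefficients of Mathlib's
`WeierstrassCurve.LFunction`.

**Proof.** Both curves have good reduction at `p` (`p ∤ N`,
`WeierstrassCurve.dvd_conductorNorm_iff_not_hasGoodReductionAtPrime`). Choose the place `v` of `ℚ` at
`p`, a prime `𝔓` of `\bar ℤ` above `v` and an arithmetic Frobenius `σ ∈ Gal(ℚ̄/ℚ)` at `𝔓`
(`primesAbove_nonempty`, `exists_isArithFrobAt_of_mem_primesAbove_holds`). Serre's congruence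
`tr(σ | E[ℓ]) = a_p mod ℓ` (the tree's theorem `WeierstrassCurve.trace_galoisRepTorsion_frobenius_eq`,
Serre 1981 (238); with `a_p = frobeniusTrace = LFunction p`,
`WeierstrassCurve.LFunction_apply_prime_eq_frobeniusTrace`) holds for `W` and for `W'` with the SAME
`σ`; and the two traces agree because the additive — hence `𝔽_ℓ`-linear — isomorphism `e` conjugates
`ρ̄_{W,ℓ}(σ)` into `ρ̄_{W',ℓ}(σ)` by equivariance (`trace_galoisRepTorsion_eq_of_equivariant`, from
Mathlib's `LinearMap.trace_conj'`).

References: J.-P. Serre, *Quelques applications du théorème de densité de Chebotarev*, Publ. Math.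
IHÉS 54 (1981), §8.1 eq. (238); J. H. Silverman, *The Arithmetic of Elliptic Curves*, III.7, VII.4,
C.21 Remark 21.3.
-/

set_option linter.dupNamespace false

noncomputable section

open scoped Classical NumberField

namespace Summit.ABC.ABC.Theorems.PolyFreyMazurPairs

open WeierstrassCurve Literature.NumberTheory.EllipticCurves IsDedekindDomain NumberField
  Rat.HeightOneSpectrum Field

/-- **Equivariantly isomorphic torsion modules have the same traces.** For Weierstrass curves `W, W'`
over a field `F`, `n : ℕ`, a group isomorphism `e : W[n] ≃+ W'[n]` commuting with `Γ_F`, and any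
`σ ∈ Γ_F`, the traces of `σ` on the `ℤ/n`-modules `W[n]` and `W'[n]` coincide: `e` is `ℤ/n`-linear and
`e ∘ ρ̄_W(σ) ∘ e⁻¹ = ρ̄_{W'}(σ)`, so this is invariance of the trace under conjugation
(`LinearMap.trace_conj'`). Silverman, *AEC*, III.7. [folklore] -/
theorem trace_galoisRepTorsion_eq_of_equivariant {F : Type*} [Field F] (W W' : WeierstrassCurve F)
    (n : ℕ) (e : W.geomTorsion n ≃+ W'.geomTorsion n)
    (he : ∀ (σ : absoluteGaloisGroup F) (P : W.geomTorsion n), e (σ • P) = σ • e P)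
    (σ : absoluteGaloisGroup F) :
    letI : Module (ZMod n) (W.geomTorsion n) := AddSubgroup.torsionBy.zmodModule
    letI : Module (ZMod n) (W'.geomTorsion n) := AddSubgroup.torsionBy.zmodModule
    LinearMap.trace (ZMod n) (W.geomTorsion n)
        ((galoisRepTorsion W n σ).toAdd.toAddMonoidHom.toZModLinearMap n) =
      LinearMap.trace (ZMod n) (W'.geomTorsion n)
        ((galoisRepTorsion W' n σ).toAdd.toAddMonoidHom.toZModLinearMap n) := by
  letI : Module (ZMod n) (W.geomTorsion n) := AddSubgroup.torsionBy.zmodModule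
  letI : Module (ZMod n) (W'.geomTorsion n) := AddSubgroup.torsionBy.zmodModule
  -- `e` as a `ℤ/n`-linear equivalence
  let E : W.geomTorsion n ≃ₗ[ZMod n] W'.geomTorsion n :=
    { e with map_smul' := fun c x ↦ ZMod.map_smul e.toAddMonoidHom c x }
  have hE : ∀ P, E P = e P := fun _ ↦ rfl
  set f := (galoisRepTorsion W n σ).toAdd.toAddMonoidHom.toZModLinearMap n with hf
  set f' := (galoisRepTorsion W' n σ).toAdd.toAddMonoidHom.toZModLinearMap n with hf'
  have hfapply : ∀ P, f P = σ • P := fun _ ↦ rfl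
  have hf'apply : ∀ Q, f' Q = σ • Q := fun _ ↦ rfl
  have hconj : E.conj f = f' := by
    refine LinearMap.ext fun Q ↦ ?_
    rw [LinearEquiv.conj_apply]
    simp only [LinearMap.comp_apply, LinearEquiv.coe_coe]
    rw [hf'apply, hfapply, hE, he]
    congr 1
    exact e.apply_symm_apply Q
  rw [← hconj, LinearMap.trace_conj']

/-- **stub 3b of the line `sturm-window-effective-smo` — a torsion isomorphism is a trace
congruence (global minimal models).** For elliptic curves `W, W'/ℚ` given by globally minimal
Weierstrass equations, a prime `ℓ`, a `Gal(ℚ̄/ℚ)`-equivariant group isomorphism `e : W[ℓ] ≃+ W'[ℓ]`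
of geometric `ℓ`-torsion and a prime `p ≠ ℓ` with `p ∤ N_W N_{W'}`:
`a_p(W) ≡ a_p(W') (mod ℓ)` for the coefficients of Mathlib's `WeierstrassCurve.LFunction`.
Serre 1981, (238): `tr ρ̄_{E,ℓ}(Frob_p) ≡ a_p (mod ℓ)` for both curves at a common arithmetic
Frobenius, and conjugation invariance of the trace along `e`.
[cite: Serre1981, §8.1 eq. (238) (p. 188)] -/
theorem stub_traceCongruenceMinimal :
    ∀ (W W' : WeierstrassCurve ℚ) [W.IsElliptic] [W'.IsElliptic] [W.IsGloballyMinimal]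
      [W'.IsGloballyMinimal] (ℓ : ℕ), ℓ.Prime →
      ∀ e : W.geomTorsion ℓ ≃+ W'.geomTorsion ℓ,
        (∀ (σ : Field.absoluteGaloisGroup ℚ) (P : W.geomTorsion ℓ), e (σ • P) = σ • e P) →
        ∀ p : ℕ, p.Prime → p ≠ ℓ → ¬ p ∣ W.conductorNorm ℤ * W'.conductorNorm ℤ →
          ((W.LFunction p - W'.LFunction p : ℤ) : ZMod ℓ) = 0 := by
  intro W W' _ _ _ _ ℓ hℓ e he p hp hpℓ hpNN
  haveI : Fact ℓ.Prime := ⟨hℓ⟩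
  haveI : Fact p.Prime := ⟨hp⟩
  -- good reduction at `p` of both curves
  have hgood : W.HasGoodReductionAtPrime p := by
    by_contra h
    exact hpNN (dvd_mul_of_dvd_left
      ((W.dvd_conductorNorm_iff_not_hasGoodReductionAtPrime p).mpr h) _)
  have hgood' : W'.HasGoodReductionAtPrime p := by
    by_contra h
    exact hpNN (dvd_mul_of_dvd_right
      ((W'.dvd_conductorNorm_iff_not_hasGoodReductionAtPrime p).mpr h) _)
  -- the place `v` at `p`, a prime `𝔓 ∣ v` of `\bar ℤ`, an arithmetic Frobenius `σ` at `𝔓`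
  obtain ⟨v, hv⟩ : ∃ v : HeightOneSpectrum (𝓞 ℚ), (primesEquiv v : ℕ) = p :=
    ⟨primesEquiv.symm ⟨p, hp⟩, by rw [Equiv.apply_symm_apply]⟩
  obtain ⟨𝔓, h𝔓⟩ := v.primesAbove_nonempty
  obtain ⟨σ, hσ⟩ := HeightOneSpectrum.exists_isArithFrobAt_of_mem_primesAbove_holds h𝔓
  -- Serre (238) for both curves, and the conjugation invariance of the trace
  have h1 := W.trace_galoisRepTorsion_frobenius_eq ℓ hpℓ hgood hv h𝔓 hσ
  have h2 := W'.trace_galoisRepTorsion_frobenius_eq ℓ hpℓ hgood' hv h𝔓 hσ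
  have h3 := trace_galoisRepTorsion_eq_of_equivariant W W' ℓ e he σ
  have key : (W.frobeniusTrace p : ZMod ℓ) = (W'.frobeniusTrace p : ZMod ℓ) := by
    rw [← h1, ← h2]
    exact h3
  rw [W.LFunction_apply_prime_eq_frobeniusTrace p hgood,
    W'.LFunction_apply_prime_eq_frobeniusTrace p hgood', Int.cast_sub, key, sub_self]

end Summit.ABC.ABC.Theorems.PolyFreyMazurPairs

end
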